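import Mathlib
import HarnessLib
import Summits.QuantumFields.YangMills.Theorems.HypercubicLimit.Negative.ReflectedDensity
import Summits.QuantumFields.YangMills.Theorems.FradkinShenkerFlowFiniteSusceptibilityWeakCouplingRPCauchySchwarz
import Literature.MathematicalPhysics.AQFT.OSAxiomsSchwinger
import Literature.MathematicalPhysics.QuantumFieldTheory.OSData
import Literature.MathematicalPhysics.QuantumLattice.LatticeScalarField
import Literature.MathematicalPhysics.QuantumFieldTheory.LatticeGaugeStaticPotentialProofs
import Literature.Probability.LatticeModels.ThermodynamicLimit

/-!
# c1 blocks, wave 2, for the closure of line `conditional-mean-telescoping` (crux stmt-QuantumFields-8646)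

Gap / cluster legs of `stub_closure`: (i) torus translation invariance of plaquette-string moments,
(ii) inheritance of `HasMassGap` along pointwise limits on `⁰𝒮` from an asymptotically uniform
clustering bound, (iii) inheritance of E4 (`HasClusterProperty`) likewise, (iv) polarisation of the
diagonal RP-spectral slab clustering of `GapData` (iii) to pairs of slab functionals.  Def-free
statements over tree objects; each `theorem` is registered (`workitem stub-add`) and proved in its own
`--supports` file.
-/

noncomputable section

open scoped SchwartzMap ComplexConjugate
open MeasureTheory Filter Topology
open Literature.MathematicalPhysics.AQFT Literature.MathematicalPhysics.QuantumLattice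
open Literature.MathematicalPhysics.QuantumFieldTheory
open Literature.Probability.LatticeModels (box Site)
open Summit.QuantumFields.YangMills.Theorems.HypercubicLimit.Negative (torusPlaquette thetaZ)

namespace Summit.QuantumFields.YangMills.Cruxes.HypercubicLimit.ConditionalMeanTelescoping

/-- **Block M-τ (moment identity under torus translations).** The centred torus moment of a
plaquette string is invariant under a simultaneous translation of all corners by `v ∈ ℤ⁴`
(translation invariance of Wilson's torus measure, periodic lift). -/
theorem rpBlock_momentShift :
    ∀ (G : Type) [Group G] [TopologicalSpace G] [IsTopologicalGroup G] [CompactSpace G]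
      [MeasurableSpace G] [BorelSpace G] (r : LatticeRep G) (β : ℝ) (L n : ℕ)
      (q : Fin n → Fin 4 × Fin 4) (m : Fin n → ℝ) (x : Fin n → (Fin 4 → ℤ)) (v : Fin 4 → ℤ),
        (∫ U, ∏ k, (torusPlaquette r (2 * L + 1) (q k).1 (q k).2 (x k + v) U - m k)
            ∂(wilsonMeasure r.ρ β : Measure (GaugeConfig 4 (2 * L + 1) G))) =
          ∫ U, ∏ k, (torusPlaquette r (2 * L + 1) (q k).1 (q k).2 (x k) U - m k)
            ∂(wilsonMeasure r.ρ β : Measure (GaugeConfig 4 (2 * L + 1) G)) := by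
  sorry

/-- **Block GAP-inh (a mass gap is inherited along pointwise limits on `⁰𝒮`).** If `S j → T` on
`⁰𝒮` and, for every pair of time-ordered `F, G`, the OS-form clustering bound
`‖S j (ΘF* ⊗ T_t G) − S j (ΘF*) S j (G)‖ ≤ C e^{−Δt} + δ` holds eventually in `j` for every `δ > 0`
(the constant `C` depending on `F, G` only), then the limit family has `HasMassGap Δ`. -/
theorem rpBlock_gapInheritance :
    ∀ (d : ℕ) [NeZero d] (S : ℕ → SchwingerFamily (EuclideanSpace ℝ (Fin d)))
      (T : SchwingerFamily (EuclideanSpace ℝ (Fin d))) (Δ : ℝ),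
      (∀ (n : ℕ) (F : 𝓢((Fin n → EuclideanSpace ℝ (Fin d)), ℂ)), IsOffDiagonal F →
        Tendsto (fun j => S j n F) atTop (𝓝 (T n F))) →
      (∀ (n m : ℕ) (F : 𝓢((Fin n → EuclideanSpace ℝ (Fin d)), ℂ))
          (G : 𝓢((Fin m → EuclideanSpace ℝ (Fin d)), ℂ)), IsTimeOrdered F → IsTimeOrdered G →
        ∃ C : ℝ, ∀ t : ℝ, 0 ≤ t → ∀ H : 𝓢((Fin (n + m) → EuclideanSpace ℝ (Fin d)), ℂ),
          IsAppendTensorOf H (osAdjoint F) (translateMulti (EuclideanSpace.single 0 t) G) →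
            ∀ δ : ℝ, 0 < δ → ∀ᶠ j in atTop,
              ‖S j (n + m) H - S j n (osAdjoint F) * S j m G‖ ≤ C * Real.exp (-Δ * t) + δ) →
      (SchwingerFamily.toLabelled T).HasMassGap Δ := by
  sorry

/-- **Block E4-inh (the cluster property is inherited along pointwise limits on `⁰𝒮`).** If
`S j → T` on `⁰𝒮` and, for every pair of time-ordered `F, G`, every non-zero spatial `a` and every
family of witnesses `H t` of `ΘF* ⊗ G(· − t a)`, for every `δ > 0` there is `t₀` beyond which the
truncated quantity is eventually (in `j`) at most `δ`, then `T` has the cluster property E4. -/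
theorem rpBlock_clusterInheritance :
    ∀ (d : ℕ) [NeZero d] (S : ℕ → SchwingerFamily (EuclideanSpace ℝ (Fin d)))
      (T : SchwingerFamily (EuclideanSpace ℝ (Fin d))),
      (∀ (n : ℕ) (F : 𝓢((Fin n → EuclideanSpace ℝ (Fin d)), ℂ)), IsOffDiagonal F →
        Tendsto (fun j => S j n F) atTop (𝓝 (T n F))) →
      (∀ (n m : ℕ) (F : 𝓢((Fin n → EuclideanSpace ℝ (Fin d)), ℂ))
          (G : 𝓢((Fin m → EuclideanSpace ℝ (Fin d)), ℂ)), IsTimeOrdered F → IsTimeOrdered G →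
        ∀ a : EuclideanSpace ℝ (Fin d), a 0 = 0 → a ≠ 0 →
          ∀ H : ℝ → 𝓢((Fin (n + m) → EuclideanSpace ℝ (Fin d)), ℂ),
            (∀ t, IsAppendTensorOf (H t) (osAdjoint F) (translateMulti (t • a) G)) →
              ∀ δ : ℝ, 0 < δ → ∃ t₀ : ℝ, ∀ t : ℝ, t₀ ≤ t → ∀ᶠ j in atTop,
                ‖S j (n + m) (H t) - S j n (osAdjoint F) * S j m G‖ ≤ δ) →
      (SchwingerFamily.toLabelled T).HasClusterProperty := by
  sorry

/-- **Block POL (polarisation of the diagonal slab clustering).** On the odd torus of side `2S+1` at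
coupling `β`, if EVERY bounded measurable real functional `Y` of the time slab `[1, T]` satisfies the
diagonal RP-spectral clustering inequality of `GapData` (iii) at separation `n` with rate factor `θ`
and slack `ε B²`, then every PAIR `Y, Y'` of such functionals (common bound `B`) satisfies the
off-diagonal bound `|⟨ΘY · τₙY'⟩ − ⟨Y⟩⟨Y'⟩| ≤ ½ θ (B₀(Y) + B₀(Y')) + 2 ε B²` (`B₀` the RP squares):
apply the hypothesis to `Y ± Y'` and use bilinearity and the symmetry
`⟨ΘY · τₙY'⟩ = ⟨ΘY' · τₙY⟩` (Θ- and translation invariance of the torus state, `Θ τₙ = τ₋ₙ Θ`). -/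
theorem rpBlock_polarisedClustering :
    ∀ (G : Type) [Group G] [TopologicalSpace G] [IsTopologicalGroup G] [CompactSpace G]
      [MeasurableSpace G] [BorelSpace G] (r : LatticeRep G) (β : ℝ) (S T n : ℕ) (θ ε : ℝ),
      (∀ (Y : LGConfig 4 G → ℝ) (B : ℝ), Measurable Y → (∀ U, |Y U| ≤ B) →
        DependsOn Y {e : Literature.MathematicalPhysics.QuantumLattice.ZdEdge 4 |
          1 ≤ e.1 0 ∧ e.1 0 + (if e.2 = 0 then 1 else 0) ≤ T} →
          |(∫ U, Y (torusLift (2 * S + 1) (GaugeConfig.timeReflect U)) *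
                Y (configShift (-Pi.single 0 (n : ℤ)) (torusLift (2 * S + 1) U))
              ∂(wilsonMeasure r.ρ β : Measure (GaugeConfig 4 (2 * S + 1) G))) -
            (∫ U, Y (torusLift (2 * S + 1) U)
              ∂(wilsonMeasure r.ρ β : Measure (GaugeConfig 4 (2 * S + 1) G))) ^ 2| ≤
            θ * ((∫ U, Y (torusLift (2 * S + 1) (GaugeConfig.timeReflect U)) * Y (torusLift (2 * S + 1) U)
                    ∂(wilsonMeasure r.ρ β : Measure (GaugeConfig 4 (2 * S + 1) G))) -
                  (∫ U, Y (torusLift (2 * S + 1) U)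
                    ∂(wilsonMeasure r.ρ β : Measure (GaugeConfig 4 (2 * S + 1) G))) ^ 2) +
              ε * B ^ 2) →
      ∀ (Y Y' : LGConfig 4 G → ℝ) (B : ℝ), Measurable Y → Measurable Y' →
        (∀ U, |Y U| ≤ B) → (∀ U, |Y' U| ≤ B) →
        DependsOn Y {e : Literature.MathematicalPhysics.QuantumLattice.ZdEdge 4 |
          1 ≤ e.1 0 ∧ e.1 0 + (if e.2 = 0 then 1 else 0) ≤ T} →
        DependsOn Y' {e : Literature.MathematicalPhysics.QuantumLattice.ZdEdge 4 |
          1 ≤ e.1 0 ∧ e.1 0 + (if e.2 = 0 then 1 else 0) ≤ T} →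
          |(∫ U, Y (torusLift (2 * S + 1) (GaugeConfig.timeReflect U)) *
                Y' (configShift (-Pi.single 0 (n : ℤ)) (torusLift (2 * S + 1) U))
              ∂(wilsonMeasure r.ρ β : Measure (GaugeConfig 4 (2 * S + 1) G))) -
            (∫ U, Y (torusLift (2 * S + 1) U)
                ∂(wilsonMeasure r.ρ β : Measure (GaugeConfig 4 (2 * S + 1) G))) *
              (∫ U, Y' (torusLift (2 * S + 1) U)
                ∂(wilsonMeasure r.ρ β : Measure (GaugeConfig 4 (2 * S + 1) G)))| ≤
            θ * (2⁻¹ : ℝ) *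
                (((∫ U, Y (torusLift (2 * S + 1) (GaugeConfig.timeReflect U)) * Y (torusLift (2 * S + 1) U)
                      ∂(wilsonMeasure r.ρ β : Measure (GaugeConfig 4 (2 * S + 1) G))) -
                    (∫ U, Y (torusLift (2 * S + 1) U)
                      ∂(wilsonMeasure r.ρ β : Measure (GaugeConfig 4 (2 * S + 1) G))) ^ 2) +
                  ((∫ U, Y' (torusLift (2 * S + 1) (GaugeConfig.timeReflect U)) * Y' (torusLift (2 * S + 1) U)
                      ∂(wilsonMeasure r.ρ β : Measure (GaugeConfig 4 (2 * S + 1) G))) -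
                    (∫ U, Y' (torusLift (2 * S + 1) U)
                      ∂(wilsonMeasure r.ρ β : Measure (GaugeConfig 4 (2 * S + 1) G))) ^ 2)) +
              2 * ε * B ^ 2 := by
  sorry

end Summit.QuantumFields.YangMills.Cruxes.HypercubicLimit.ConditionalMeanTelescoping

end
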